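import Summits.BirchSwinnertonDyer.BirchSwinnertonDyer.Theses.AdditiveKolyvaginRoad
import Summits.BirchSwinnertonDyer.BirchSwinnertonDyer.Theorems.AdditiveKolyvaginRoadLevelSystems

/-! # LevelKolyvaginSystemsAdditive — line `birth` (BC3 skeleton, tenure desk bsd-wall-add g7, 2026-08-27)
Crux item (route AdditiveKolyvaginRoad, PROMOTED STUB of crux r2's line `birth` v8, lead akr-p1 g3 handback):
`Summit.BirchSwinnertonDyer.BirchSwinnertonDyer.Theses.AdditiveKolyvaginRoad.LevelKolyvaginSystemsAdditive`.
CUT = BY LOCAL TYPE at the additive prime p (the literature's cut: the rank-0 anchor / level raising / multiplicity one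
inputs differ by inertial type): stub AB on the ABELIAN locus `SubM W p ∨ SubGord W p` (ρ_{{E,p}}|G_p semistable over an
abelian tame extension: tame branch g_ε ∕ twisted Brandt bottom, Zhang (4.8) for the semistable twist when e = 2) and
stub NA on the NON-ABELIAN locus `SubTprime W p ∨ SubW W p` (supercuspidal type: cuspidal-K-type Brandt module
`cuspidalTypeBrandtModule`, multiplicity one only on the EGS-generic locus; SubW vacuous for p ≥ 5); composed by
`Rank1Residual.Additive.sub_exhaustive`. Statements = the crux VERBATIM with the type disjunct inserted after `Addv W p`
(same texts as the registered children skeletons' KS-AB 5f421462fb89 / KS-NA c0d4a20ae82b).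
Anchor map (why each stub is open, with locators): Cruxes/LevelKolyvaginSystemsAdditive/MEMO-anchor-v1.md. -/

set_option autoImplicit false

noncomputable section

open scoped Classical

open WeierstrassCurve NumberField Literature.NumberTheory.EllipticCurves
  Literature.NumberTheory.EllipticCurves.ModularForms Literature.NumberTheory.EllipticCurves.Rank1Residual
  Summit.BirchSwinnertonDyer.Rank1Residual Summit.BirchSwinnertonDyer.Rank1Residual.Additive
  Summit.BirchSwinnertonDyer.BirchSwinnertonDyer.Theses.AdditiveKolyvaginRoad
  Summit.BirchSwinnertonDyer.BirchSwinnertonDyer.Theorems.AdditiveKoly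

namespace Summit.BirchSwinnertonDyer.BirchSwinnertonDyer.Cruxes.LevelKolyvaginSystemsAdditive.Birth

/-- stub AB: the crux on the ABELIAN-TYPE locus (SubM ∨ SubGord). -/
theorem stub_levelKolyvaginSystemsAbelianType :
  ∀ (W : WeierstrassCurve ℚ) [W.IsElliptic] [W.IsGloballyMinimal] [NeZero (W.conductorNorm ℤ)]
    (p : ℕ) [Fact p.Prime] (K : Type) [Field K] [NumberField K]
    (Dt : ModularParametrizationData W (W.conductorNorm ℤ)) (β : ℤ) (ι : K →+* ℂ),
    5 ≤ p → Addv W p → (Summit.BirchSwinnertonDyer.Rank1Residual.Additive.SubM W p ∨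
      Summit.BirchSwinnertonDyer.Rank1Residual.Additive.SubGord W p) → W.HasSurjectiveModNGaloisRep p →
    (∀ (ℓ : ℕ) [Fact ℓ.Prime], W.HasMultiplicativeReductionAtPrime ℓ →
      ¬ p ∣ padicValInt ℓ W.minimalDiscriminantInt) →
    (∃ (ℓ₁ ℓ₂ : ℕ) (_ : Fact ℓ₁.Prime) (_ : Fact ℓ₂.Prime), ℓ₁ ≠ ℓ₂ ∧
      W.HasMultiplicativeReductionAtPrime ℓ₁ ∧ W.HasMultiplicativeReductionAtPrime ℓ₂) →
    ¬ p ∣ W.tamagawaProduct → W.analyticRank = 1 →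
    IsImaginaryQuadratic K → Odd (NumberField.discr K) → NumberField.discr K < -4 →
    SatisfiesHeegnerHypothesis (W.conductorNorm ℤ) K →
    (W.quadraticTwist (NumberField.discr K : ℚ)).entireLFunction 1 ≠ 0 →
    (4 * (W.conductorNorm ℤ : ℤ)) ∣ β ^ 2 - NumberField.discr K → ¬ (p : ℤ) ∣ Dt.c →
    ∀ (c : K ≃ₐ[ℚ] K), c ≠ 1 → ∀ [Module (ZMod p) (Vp W K p)],
    Nonempty (LevelKolyvaginSystemP W K p Dt β ι c) := by
  sorry

/-- stub NA: the crux on the NON-ABELIAN-TYPE locus (SubTprime ∨ SubW). -/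
theorem stub_levelKolyvaginSystemsNonAbelianType :
  ∀ (W : WeierstrassCurve ℚ) [W.IsElliptic] [W.IsGloballyMinimal] [NeZero (W.conductorNorm ℤ)]
    (p : ℕ) [Fact p.Prime] (K : Type) [Field K] [NumberField K]
    (Dt : ModularParametrizationData W (W.conductorNorm ℤ)) (β : ℤ) (ι : K →+* ℂ),
    5 ≤ p → Addv W p → (Summit.BirchSwinnertonDyer.Rank1Residual.Additive.SubTprime W p ∨
      Summit.BirchSwinnertonDyer.Rank1Residual.Additive.SubW W p) → W.HasSurjectiveModNGaloisRep p →
    (∀ (ℓ : ℕ) [Fact ℓ.Prime], W.HasMultiplicativeReductionAtPrime ℓ →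
      ¬ p ∣ padicValInt ℓ W.minimalDiscriminantInt) →
    (∃ (ℓ₁ ℓ₂ : ℕ) (_ : Fact ℓ₁.Prime) (_ : Fact ℓ₂.Prime), ℓ₁ ≠ ℓ₂ ∧
      W.HasMultiplicativeReductionAtPrime ℓ₁ ∧ W.HasMultiplicativeReductionAtPrime ℓ₂) →
    ¬ p ∣ W.tamagawaProduct → W.analyticRank = 1 →
    IsImaginaryQuadratic K → Odd (NumberField.discr K) → NumberField.discr K < -4 →
    SatisfiesHeegnerHypothesis (W.conductorNorm ℤ) K →
    (W.quadraticTwist (NumberField.discr K : ℚ)).entireLFunction 1 ≠ 0 →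
    (4 * (W.conductorNorm ℤ : ℤ)) ∣ β ^ 2 - NumberField.discr K → ¬ (p : ℤ) ∣ Dt.c →
    ∀ (c : K ≃ₐ[ℚ] K), c ≠ 1 → ∀ [Module (ZMod p) (Vp W K p)],
    Nonempty (LevelKolyvaginSystemP W K p Dt β ι c) := by
  sorry

/-- COMPOSITION (kernel-checked, no sorry of its own): the crux BY NAME, proved outright from the two (sorried) by-type stubs, by exhaustiveness of the
four census cells `sub_exhaustive : SubM ∨ SubGord ∨ SubTprime ∨ SubW`. -/
theorem LevelKolyvaginSystemsAdditive_of :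
    Summit.BirchSwinnertonDyer.BirchSwinnertonDyer.Theses.AdditiveKolyvaginRoad.LevelKolyvaginSystemsAdditive := by
  intro W _ _ _ p _ K _ _ Dt β ι hp hadd hs hsp htwo htam hr hK hodd hlt hH hL hβ hc c hc1 _
  rcases Summit.BirchSwinnertonDyer.Rank1Residual.Additive.sub_exhaustive W p with h | h | h | h
  · exact stub_levelKolyvaginSystemsAbelianType W p K Dt β ι hp hadd (Or.inl h) hs hsp htwo htam hr hK hodd hlt hH hL hβ hc c hc1
  · exact stub_levelKolyvaginSystemsAbelianType W p K Dt β ι hp hadd (Or.inr h) hs hsp htwo htam hr hK hodd hlt hH hL hβ hc c hc1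
  · exact stub_levelKolyvaginSystemsNonAbelianType W p K Dt β ι hp hadd (Or.inl h) hs hsp htwo htam hr hK hodd hlt hH hL hβ hc c hc1
  · exact stub_levelKolyvaginSystemsNonAbelianType W p K Dt β ι hp hadd (Or.inr h) hs hsp htwo htam hr hK hodd hlt hH hL hβ hc c hc1

end Summit.BirchSwinnertonDyer.BirchSwinnertonDyer.Cruxes.LevelKolyvaginSystemsAdditive.Birth

end
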